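import Literature.AnabelianGeometry.SemiGraphs.TemperedFunctorialityWith
import Literature.AnabelianGeometry.SemiGraphs.TemperoidsHomEqResProofs
import HarnessLib

/-!
# Semi-graphs of anabelioids, §3, Proposition 3.6 (iv) — exactness and the Proposition 3.2 step for an
# ARBITRARY family of conjugating elements (cell ruling ξ2, RQ12)

Mochizuki, *Semi-graphs of anabelioids*, Publ. RIMS **42** (2006), §3, Proposition 3.6 (iv), manuscript
p. 39 [cite: MochizukiSemiAnbd2006, Prop 3.6(iv) p.39].  Sequel of `TemperedFunctorialityWith.lean`: the
every-`θ` forms of `TemperedFunctorialityExactProofs.lean` / `TemperedFunctorialityHomProofs.lean`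
(the proofs never use the conjugating elements except through the definitional squares
`F^*_θ ⋙ (S ↦ S_{v'}) = (S ↦ S_{F v'}) ⋙ B^temp(F_{v'})`, so they port by substitution):

* `preservesLimitsOfShape_covPullbackWith` / `preservesColimitsOfShape_covPullbackWith` (+ `B^temp`
  forms) — `F^*_θ` preserves finite limits and countable colimits;
* `temperoidHomWith θ`, `chartTemperoidHomWith θ c' c` — the morphisms of temperoids;
* `conj_of_chartPullbackWith_iso` (+ `_edge`) — the verticial / edge compatibility of ANY continuous
  `φ` with `B^temp(φ) ≅ chartPullbackWith θ c' c`;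
* `exists_inducedHom_with` — clause 1 of `InducedHomOfMorphism`
  for the pull-back along `θ` (Proposition 3.2's surjectivity half `TemperoidHomEqRes_holds`, seat
  abc-iut-L3-d2).
Nothing here takes a side on [IUTchIII] Cor. 3.12.
-/

noncomputable section

namespace Literature.AnabelianGeometry.SemiGraphs

namespace ProfiniteSemiGraph

open CategoryTheory CategoryTheory.Limits

universe u

variable {𝒢' 𝒢 : ProfiniteSemiGraph.{u}}

namespace Hom

variable (F : Hom 𝒢' 𝒢) (θ : F.ConjugatorFamily)

/-- **`F^* : B^cov(G) ⥤ B^cov(G')` preserves finite limits** (restriction to `v'` after `F^*` is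
restriction to `F v'` followed by `B^temp(F_{v'})`, both of which preserve finite limits, and limits of
`B^cov(G')` are detected fibre by fibre). [cite: MochizukiSemiAnbd2006, Prop 3.6(iv) p.39] -/
theorem preservesLimitsOfShape_covPullbackWith (J : Type) [SmallCategory J] [FinCategory J] :
    PreservesLimitsOfShape J (F.covPullbackWith θ) := by
  haveI : ∀ v, PreservesLimitsOfShape J (restrictV 𝒢 v) :=
    fun v => CovObj.preservesLimitsOfShape_restrictV 𝒢 v
  haveI : ∀ e, PreservesLimitsOfShape J (restrictE 𝒢 e) :=
    fun e => CovObj.preservesLimitsOfShape_restrictE 𝒢 e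
  haveI : ∀ v', PreservesLimitsOfShape J (BTemp.res (F.hV v')) :=
    fun v' => btempRes_preservesLimitsOfShape (F.hV v') J
  haveI : ∀ e', PreservesLimitsOfShape J (BTemp.res (F.hE e')) :=
    fun e' => btempRes_preservesLimitsOfShape (F.hE e') J
  refine ⟨fun {K} => ⟨fun {c} hc => CovObj.isLimitOfComponents _ (fun v' => ?_) (fun e' => ?_)⟩⟩
  · change IsLimit ((F.covPullbackWith θ ⋙ restrictV 𝒢' v').mapCone c)
    rw [F.covPullbackWith_comp_restrictV θ v']
    exact isLimitOfPreserves _ hc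
  · change IsLimit ((F.covPullbackWith θ ⋙ restrictE 𝒢' e').mapCone c)
    rw [F.covPullbackWith_comp_restrictE θ e']
    exact isLimitOfPreserves _ hc

/-- `F^*` preserves finite limits. [cite: MochizukiSemiAnbd2006, Prop 3.6(iv) p.39] -/
theorem preservesFiniteLimits_covPullbackWith : PreservesFiniteLimits (F.covPullbackWith θ) :=
  ⟨fun J _ _ => F.preservesLimitsOfShape_covPullbackWith θ J⟩

/-- **`F^* : B^cov(G) ⥤ B^cov(G')` preserves countable colimits.**
[cite: MochizukiSemiAnbd2006, Prop 3.6(iv) p.39] -/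
theorem preservesColimitsOfShape_covPullbackWith (J : Type) [SmallCategory J] [CountableCategory J] :
    PreservesColimitsOfShape J (F.covPullbackWith θ) := by
  haveI : ∀ v, PreservesColimitsOfShape J (restrictV 𝒢 v) :=
    fun v => CovObj.preservesColimitsOfShape_restrictV 𝒢 v
  haveI : ∀ e, PreservesColimitsOfShape J (restrictE 𝒢 e) :=
    fun e => CovObj.preservesColimitsOfShape_restrictE 𝒢 e
  haveI : ∀ v', PreservesColimitsOfShape J (BTemp.res (F.hV v')) :=
    fun v' => btempRes_preservesColimitsOfShape (F.hV v') J
  haveI : ∀ e', PreservesColimitsOfShape J (BTemp.res (F.hE e')) :=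
    fun e' => btempRes_preservesColimitsOfShape (F.hE e') J
  refine ⟨fun {K} => ⟨fun {c} hc => CovObj.isColimitOfComponents _ (fun v' => ?_) (fun e' => ?_)⟩⟩
  · change IsColimit ((F.covPullbackWith θ ⋙ restrictV 𝒢' v').mapCocone c)
    rw [F.covPullbackWith_comp_restrictV θ v']
    exact isColimitOfPreserves _ hc
  · change IsColimit ((F.covPullbackWith θ ⋙ restrictE 𝒢' e').mapCocone c)
    rw [F.covPullbackWith_comp_restrictE θ e']
    exact isColimitOfPreserves _ hc

/-! ### `F^* : B^temp(G) ⥤ B^temp(G')` is a morphism of temperoids -/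

/-- `F^*` on the tempered objects preserves finite limits. [cite: MochizukiSemiAnbd2006, Prop 3.6(iv) p.39] -/
theorem preservesLimitsOfShape_btempPullbackWith (J : Type) [SmallCategory J] [FinCategory J] :
    PreservesLimitsOfShape J (F.btempPullbackWith θ) := by
  haveI := isTempered_isClosedUnderLimitsOfShape (𝒢 := 𝒢) J
  haveI := isTempered_isClosedUnderLimitsOfShape (𝒢 := 𝒢') J
  haveI := CovObj.hasLimitsOfShape (𝒢 := 𝒢) (J := J)
  haveI := CovObj.hasLimitsOfShape (𝒢 := 𝒢') (J := J)
  haveI := F.preservesLimitsOfShape_covPullbackWith θ J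
  haveI : PreservesLimitsOfShape J (F.btempPullbackWith θ ⋙ ObjectProperty.ι _) := by
    rw [F.btempPullbackWith_comp_ι θ]
    infer_instance
  exact preservesLimitsOfShape_of_reflects_of_preserves (F.btempPullbackWith θ) (ObjectProperty.ι _)

/-- `F^*` on the tempered objects preserves countable colimits. [cite: MochizukiSemiAnbd2006, Prop 3.6(iv) p.39] -/
theorem preservesColimitsOfShape_btempPullbackWith (J : Type) [SmallCategory J] [CountableCategory J] :
    PreservesColimitsOfShape J (F.btempPullbackWith θ) := by
  haveI := isTempered_isClosedUnderColimitsOfShape (𝒢 := 𝒢) J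
  haveI := isTempered_isClosedUnderColimitsOfShape (𝒢 := 𝒢') J
  haveI := CovObj.hasColimitsOfShape (𝒢 := 𝒢) (J := J)
  haveI := CovObj.hasColimitsOfShape (𝒢 := 𝒢') (J := J)
  haveI := F.preservesColimitsOfShape_covPullbackWith θ J
  haveI : PreservesColimitsOfShape J (F.btempPullbackWith θ ⋙ ObjectProperty.ι _) := by
    rw [F.btempPullbackWith_comp_ι θ]
    infer_instance
  exact preservesColimitsOfShape_of_reflects_of_preserves (F.btempPullbackWith θ) (ObjectProperty.ι _)

/-- **[SemiAnbd] Proposition 3.6 (iv), first sentence**: the morphism of temperoids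
`B^temp(G') → B^temp(G)` induced by `F : G' → G` (Definition 3.1 (iii): its pull-back functor
`F^* : B^temp(G) ⥤ B^temp(G')` preserves finite limits and countable colimits).
[cite: MochizukiSemiAnbd2006, Prop 3.6(iv) p.39] -/
def temperoidHomWith : TemperoidHom (BTempCat 𝒢') (BTempCat 𝒢) where
  pullback := F.btempPullbackWith θ
  preservesFiniteLimits := ⟨fun J _ _ => F.preservesLimitsOfShape_btempPullbackWith θ J⟩
  preservesCountableColimits J _ _ := F.preservesColimitsOfShape_btempPullbackWith θ J

/-- The induced morphism of connected temperoids `B^temp(π₁^temp G') → B^temp(π₁^temp G)` through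
charts (the input of Proposition 3.2). [cite: MochizukiSemiAnbd2006, Prop 3.6(iv) p.39] -/
def chartTemperoidHomWith (c' : TemperedPiChart 𝒢') (c : TemperedPiChart 𝒢) :
    TemperoidHom (BTemp c'.G) (BTemp c.G) where
  pullback := F.chartPullbackWith θ c' c
  preservesFiniteLimits := ⟨fun J _ _ => by
    haveI := F.preservesLimitsOfShape_btempPullbackWith θ J
    unfold chartPullbackWith
    infer_instance⟩
  preservesCountableColimits J _ _ := by
    haveI := F.preservesColimitsOfShape_btempPullbackWith θ J
    unfold chartPullbackWith
    infer_instance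

/-! ### Compatibility with the verticial homomorphisms -/

/-- **[SemiAnbd] Proposition 3.6 (iv) / Theorem 3.7 (i), compatibility**: if `φ : π₁^temp(G') →
π₁^temp(G)` represents the induced morphism of temperoids (`B^temp(φ) ≅ c⁻¹ ⋙ F^* ⋙ c'`), then for
all verticial homomorphisms `ψ'` of `G'` at `v'` and `ψ` of `G` at `F v'`, the homomorphisms
`φ ∘ ψ'` and `ψ ∘ F_{v'}` are conjugate in `π₁^temp(G)`. [cite: MochizukiSemiAnbd2006, Prop 3.6(iv) p.39] -/
theorem conj_of_chartPullbackWith_iso (c' : TemperedPiChart 𝒢') (c : TemperedPiChart 𝒢)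
    (φ : c'.G →ₜ* c.G) (hφ : Nonempty (F.chartPullbackWith θ c' c ≅ BTemp.res φ))
    (v' : 𝒢'.graph.Vertex) (ψ' : 𝒢'.Gv v' →ₜ* c'.G) (ψ : 𝒢.Gv (F.base.vertexMap v') →ₜ* c.G)
    (hψ' : IsVerticialHom c' v' ψ') (hψ : IsVerticialHom c (F.base.vertexMap v') ψ) :
    ∃ g : c.G, ∀ x, φ (ψ' x) = g * ψ (F.hV v' x) * g⁻¹ := by
  obtain ⟨e⟩ := hφ
  obtain ⟨e'⟩ := hψ'
  obtain ⟨eψ⟩ := hψ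
  -- `B^temp(φ ∘ ψ') ≅ B^temp(ψ ∘ F_{v'})`
  let s3 : (c.equiv.inverse ⋙ F.btempPullbackWith θ) ⋙ (c'.equiv.functor ⋙ BTemp.res ψ') ≅
      (c.equiv.inverse ⋙ F.btempPullbackWith θ) ⋙
        (c'.equiv.functor ⋙ (c'.equiv.inverse ⋙ ObjectProperty.ι _ ⋙ restrictV 𝒢' v')) :=
    Functor.isoWhiskerLeft _ (Functor.isoWhiskerLeft _ e'.symm)
  let s4 : (c.equiv.inverse ⋙ F.btempPullbackWith θ) ⋙
        (c'.equiv.functor ⋙ (c'.equiv.inverse ⋙ ObjectProperty.ι _ ⋙ restrictV 𝒢' v')) ≅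
      (c.equiv.inverse ⋙ F.btempPullbackWith θ) ⋙ (ObjectProperty.ι _ ⋙ restrictV 𝒢' v') :=
    Functor.isoWhiskerLeft _ ((Functor.associator _ _ _).symm ≪≫
      Functor.isoWhiskerRight c'.equiv.unitIso.symm _ ≪≫ Functor.leftUnitor _)
  let s5 : (c.equiv.inverse ⋙ F.btempPullbackWith θ) ⋙ (ObjectProperty.ι _ ⋙ restrictV 𝒢' v') ≅
      (c.equiv.inverse ⋙ ObjectProperty.ι _ ⋙ restrictV 𝒢 (F.base.vertexMap v')) ⋙
        BTemp.res (F.hV v') :=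
    Iso.refl _
  let η : BTemp.res (φ.comp ψ') ≅ BTemp.res (ψ.comp (F.hV v')) :=
    (BTemp.resComp φ ψ').symm ≪≫ Functor.isoWhiskerRight e.symm (BTemp.res ψ') ≪≫ s3 ≪≫ s4 ≪≫ s5 ≪≫
      Functor.isoWhiskerRight eψ (BTemp.res (F.hV v')) ≪≫ BTemp.resComp ψ (F.hV v')
  obtain ⟨g, hg, -⟩ := BTemp.exists_conj_of_natTrans c.isTempered (φ.comp ψ') (ψ.comp (F.hV v')) η.hom
  refine ⟨g⁻¹, fun x => ?_⟩
  have h := hg x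
  change g * φ (ψ' x) * g⁻¹ = ψ (F.hV v' x) at h
  rw [← h]
  group


/-- Edge version of the compatibility: if `φ` represents the induced morphism of temperoids, then
for all edge homomorphisms `ψ'` of `G'` at `e'` and `ψ` of `G` at `F e'` (Thm. 3.7 (iii) p. 41),
`φ ∘ ψ'` and `ψ ∘ F_{e'}` are conjugate in `π₁^temp(G)`. [cite: MochizukiSemiAnbd2006, Prop 3.6(iv) p.39] -/
theorem conj_of_chartPullbackWith_iso_edge (c' : TemperedPiChart 𝒢') (c : TemperedPiChart 𝒢)
    (φ : c'.G →ₜ* c.G) (hφ : Nonempty (F.chartPullbackWith θ c' c ≅ BTemp.res φ))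
    (e' : 𝒢'.graph.Edge) (ψ' : 𝒢'.Ge e' →ₜ* c'.G) (ψ : 𝒢.Ge (F.base.edgeMap e') →ₜ* c.G)
    (hψ' : IsEdgeHom c' e' ψ') (hψ : IsEdgeHom c (F.base.edgeMap e') ψ) :
    ∃ g : c.G, ∀ x, φ (ψ' x) = g * ψ (F.hE e' x) * g⁻¹ := by
  obtain ⟨e⟩ := hφ
  obtain ⟨e''⟩ := hψ'
  obtain ⟨eψ⟩ := hψ
  let s3 : (c.equiv.inverse ⋙ F.btempPullbackWith θ) ⋙ (c'.equiv.functor ⋙ BTemp.res ψ') ≅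
      (c.equiv.inverse ⋙ F.btempPullbackWith θ) ⋙
        (c'.equiv.functor ⋙ (c'.equiv.inverse ⋙ ObjectProperty.ι _ ⋙ restrictE 𝒢' e')) :=
    Functor.isoWhiskerLeft _ (Functor.isoWhiskerLeft _ e''.symm)
  let s4 : (c.equiv.inverse ⋙ F.btempPullbackWith θ) ⋙
        (c'.equiv.functor ⋙ (c'.equiv.inverse ⋙ ObjectProperty.ι _ ⋙ restrictE 𝒢' e')) ≅
      (c.equiv.inverse ⋙ F.btempPullbackWith θ) ⋙ (ObjectProperty.ι _ ⋙ restrictE 𝒢' e') :=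
    Functor.isoWhiskerLeft _ ((Functor.associator _ _ _).symm ≪≫
      Functor.isoWhiskerRight c'.equiv.unitIso.symm _ ≪≫ Functor.leftUnitor _)
  let s5 : (c.equiv.inverse ⋙ F.btempPullbackWith θ) ⋙ (ObjectProperty.ι _ ⋙ restrictE 𝒢' e') ≅
      (c.equiv.inverse ⋙ ObjectProperty.ι _ ⋙ restrictE 𝒢 (F.base.edgeMap e')) ⋙
        BTemp.res (F.hE e') :=
    Iso.refl _
  let η : BTemp.res (φ.comp ψ') ≅ BTemp.res (ψ.comp (F.hE e')) :=
    (BTemp.resComp φ ψ').symm ≪≫ Functor.isoWhiskerRight e.symm (BTemp.res ψ') ≪≫ s3 ≪≫ s4 ≪≫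
      s5 ≪≫ Functor.isoWhiskerRight eψ (BTemp.res (F.hE e')) ≪≫ BTemp.resComp ψ (F.hE e')
  obtain ⟨g, hg, -⟩ :=
    BTemp.exists_conj_of_natTrans c.isTempered (φ.comp ψ') (ψ.comp (F.hE e')) η.hom
  refine ⟨g⁻¹, fun x => ?_⟩
  have h := hg x
  change g * φ (ψ' x) * g⁻¹ = ψ (F.hE e' x) at h
  rw [← h]
  group

/-- **Clause 1 of `InducedHomOfMorphism` for the pull-back along ANY family of conjugating elements,
UNCONDITIONAL** (Proposition 3.2, `TemperoidHomEqRes_holds`). [cite: MochizukiSemiAnbd2006, Prop 3.6(iv) p.39] -/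
theorem exists_inducedHom_with (c' : TemperedPiChart 𝒢') (c : TemperedPiChart 𝒢) :
    ∃ φ : c'.G →ₜ* c.G, Nonempty (F.chartPullbackWith θ c' c ≅ BTemp.res φ) ∧
      ∀ (v' : 𝒢'.graph.Vertex) (ψ' : 𝒢'.Gv v' →ₜ* c'.G)
        (ψ : 𝒢.Gv (F.base.vertexMap v') →ₜ* c.G),
        IsVerticialHom c' v' ψ' → IsVerticialHom c (F.base.vertexMap v') ψ →
          ∃ g : c.G, ∀ x, φ (ψ' x) = g * ψ (F.hV v' x) * g⁻¹ := by
  haveI := c'.secondCountableTopology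
  haveI := c.secondCountableTopology
  obtain ⟨φ, hφ⟩ :=
    TemperoidHomEqRes_holds c'.G c.G c'.isTempered c.isTempered (F.chartTemperoidHomWith θ c' c)
  exact ⟨φ, hφ, fun v' ψ' ψ hψ' hψ => F.conj_of_chartPullbackWith_iso θ c' c φ hφ v' ψ' ψ hψ' hψ⟩

end Hom

end ProfiniteSemiGraph

end Literature.AnabelianGeometry.SemiGraphs

end
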